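import Summits.CriticalPhenomena.CardyFormulaZ2.Theses.CardyAnchoredRigidity
import Summits.CriticalPhenomena.CardyFormulaZ2.Theses.CardyLocalRigidity
import Literature.Probability.Percolation.QuadCrossingSquareModel

/-!
# Skeleton `Lines/registered.lean` for crux `ClusterSetConnected` (stmt-CriticalPhenomena-5769)

Route `route-CriticalPhenomena-CardyAnchoredRigidity` (the crux is SHARED verbatim with
`route-CriticalPhenomena-CardyLocalRigidity`), sub-problem `CardyFormulaZ2`, crux decl
`Summit.CriticalPhenomena.CardyFormulaZ2.Theses.CardyAnchoredRigidity.ClusterSetConnected`: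

  the cluster set `Λ' = {g | g is a cluster point, as δ → 0⁺, of δ ↦ (R ↦ bondDomainCrossingProb R δ)}`
  is preconnected in the product space `ConformalRectangle → ℝ`.

RESHAPED by the lead (c2, 2026-08-17). The planner's birth skeleton cut the crux into S1 = the
support item `ScaleContinuity` (stmt-CriticalPhenomena-5770, asymptotic continuity of every
crossing probability in `log δ`) and S2 = the model-free topological lever. S1 is now DERIVED in
this file (`scaleContinuity_of_stubs`, no `sorry`) from three registered stubs that follow the
tree's Schramm–Smirnov machinery, through a square model `Φ : ℂ ≃ₜ ℂ` of the conformal rectangle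
(`exists_isSquareModel`: `Φ` maps the model square `(-1,1)²` onto `Ω` and side `k` onto `R.arc k`;
arcs `0`/`2` are the bottom/top sides, crossings are vertical) and its perturbations
`perturbQuad Φ x₀ x₁ y₀ y₁ = Φ([x₀,x₁] × [y₀,y₁])` with their continuum crossing events
`quadCrossing` (a point of arc `0` joined to a point of arc `2` by a path inside the closed quad
and the drawn open edges `openEdgeUnion δ ω` of `δℤ²`):

* `stub_walkExtraction` (S1a-W, LATTICE BOOKKEEPING; size S/M): a compact connected set inside the
  drawn open edges is shadowed by an open lattice walk between any two of its points.
* `stub_sandwichLowerOfWalks` (S1a, DETERMINISTIC GEOMETRY, the hardest; size M/L; takes S1a-W as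
  its hypothesis): for small mesh, a
  continuum open crossing of the TALL-NARROW perturbation `T_s = Φ([-1+s, 1-s] × [-1-s, 1+s])`
  (harder than `R`: it sticks out below arc `0` and above arc `2` and stays away from arcs `1`, `3`)
  forces G02's discrete crossing event `discreteCrossing Ω δ (arc 0) (arc 2)` (an open path of the
  largest mesh component `Ω_δ` between the discretised arcs): the open lattice walk carrying the
  crossing enters `Ω` across arc `0` and leaves across arc `2`; between its last bad edge at arc `0`
  and its first bad edge at arc `2` it is a walk of the mesh graph through vertices of `Ω`, anchored
  at discrete-arc vertices (boundary vertices within `δ` of arc `0`, resp. arc `2`, far from the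
  other arcs), and it meets a fixed compact `K ⊆ Ω`, whose lattice points lie in the largest
  component for small `δ` (bulk property `JordanDomain.exists_forall_mem_meshDomain_and_reachable`).
* `stub_sandwichUpper` (S1b, DETERMINISTIC GEOMETRY; size M): for small mesh, G02's discrete
  crossing forces a continuum open crossing of the WIDE-SHORT perturbation
  `W_s = Φ([-1-s, 1+s] × [-1+s, 1-s])` (easier than `R`): discrete-arc vertices are within `δ` of
  their arc, so in the model the drawn open walk starts below height `-1+s` and ends above `1-s`
  (uniform continuity of `Φ⁻¹` on the closed quad) and its passage between these heights
  (`exists_Icc_passage`) is a crossing of `W_s`.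
* `stub_perturbationContinuity` (S1c, PERCOLATION, the Schramm–Smirnov input; size M): for every
  `Φ` and `ε > 0` there are `s`, `θ`, `δ₁ > 0` with
  `P[𝒞_δ(W_s)] - P[𝒞_{δ'}(T_s)] < ε` and `P[𝒞_{δ'}(W_s)] - P[𝒞_δ(T_s)] < ε` whenever
  `0 < δ ≤ δ' < δ₁`, `δ' ≤ (1+θ)δ`. Source: the discrete continuity estimate (5.1) of
  Schramm–Smirnov 2011, PROVED in the tree for bond-`ℤ²`
  (`QuadCrossing.Quad.continuity_of_lemma_5_1 QuadCrossing.SchrammSmirnov2011_lemma_5_1_holds`,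
  uniform form `QuadCrossing.Quad.continuity_uniform_pair` on the compact family `{squareModelQuad Φ}`),
  the exact dilation covariance of the raw crossing events (`openEdgeUnion_mul`,
  `QuadCrossing.setOf_exists_isCrossing_subset_image`: `T_s` crossed at mesh `δ'` iff
  `(δ/δ') • T_s` crossed at mesh `δ`), `quadCrossing_eq_setOf_exists_isCrossing` (continuum-arc
  event = raw Schramm–Smirnov event of the modelling quad) and the elementary estimates
  `dist (κ • Q) Q ≤ |κ - 1| sup ‖Q‖`, `dist (Q_{W_s}) Q, dist (Q_{T_s}) Q → 0` (`s → 0`).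
* `stub_clusterSetPreconnected` (S2, TOPOLOGY, model-free; size M): unchanged from the birth
  skeleton — the cluster set at `0⁺` of a precompact path whose every coordinate is
  `(θ, δ₀)`-log-asymptotically continuous is preconnected (product form of Hale 2010, Lemma 3.1.1).

Composition: `scaleContinuity_of_stubs : S1a-W → S1a → S1b → S1c → ScaleContinuity` (monotonicity of
`P.real` along `𝒞_δ(T_s) ⊆ discreteCrossing ⊆ 𝒞_δ(W_s)` at both meshes) and
`ClusterSetConnected_of : S1a-W → S1a → S1b → S1c → S2 → crux` (S2 at `ι := ConformalRectangle`,
`K := [0,1]^ConformalRectangle`). `ClusterSetConnected_proof` concludes the item's default decl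
`…Theses.CardyLocalRigidity.ClusterSetConnected` (definitionally the `CardyAnchoredRigidity` one,
`crux_shared_iff`). No `sorry` outside the `stub_*` (five line stubs + two registered one-line forms of
S1a's helper files, `stub_sandwichLowerChains` / `stub_sandwichLowerGeometry`, which carry no weight in the composition).

Disproof used: none (no `Disproof.lean` on this crux, `ledger crux ls` 2026-08-17).
Dead lines avoided: none recorded. The birth stub `stub_scaleContinuity` (= item 5770 verbatim) is
superseded by S1a–S1c and re-derived here as `scaleContinuity_of_stubs`.
-/

open Filter Topology Set MeasureTheory

namespace Summit.CriticalPhenomena.CardyFormulaZ2.Cruxes.ClusterSetConnected.Birth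

open Literature.Probability.RandomPlanarGeometry Literature.Probability.Percolation
open Literature.Probability.LatticeModels

/-! ### Registered stubs (the ONLY sorries of this file) -/

/-- **stub_walkExtraction** (S1a-W, lattice bookkeeping; size S/M): a compact connected set `K`
lying in the drawn open edges `openEdgeUnion δ ω` of `δℤ²` (`δ > 0`) is shadowed by an OPEN LATTICE
WALK: for any two points `a, b ∈ K` there is a chain of lattice sites `f 0 ∼ f 1 ∼ ⋯ ∼ f (n+1)`
whose edges are open, every site within `δ` of `K`, the first drawn edge containing `a` and the
last containing `b` ("in the discrete setting there is no difference between connected and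
path-connected crossings", Schramm–Smirnov 2011 §1.3; in the tree:
`openConnIn_of_isPreconnected_subset_openEdgeUnion` + `exists_walk_of_mem_openConnIn` +
`exists_mem_edgePairs_of_mem`). -/
theorem stub_walkExtraction :
    ∀ (δ : ℝ), 0 < δ → ∀ (ω : Literature.Probability.Percolation.BondConfig (Literature.Probability.LatticeModels.Site 2))
      (K : Set ℂ), IsCompact K → IsConnected K →
      K ⊆ Literature.Probability.Percolation.openEdgeUnion δ ω → ∀ a ∈ K, ∀ b ∈ K,
        ∃ (n : ℕ) (f : ℕ → Literature.Probability.LatticeModels.Site 2),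
          a ∈ segment ℝ (Literature.Probability.LatticeModels.meshPoint δ (f 0))
              (Literature.Probability.LatticeModels.meshPoint δ (f 1)) ∧
          b ∈ segment ℝ (Literature.Probability.LatticeModels.meshPoint δ (f n))
              (Literature.Probability.LatticeModels.meshPoint δ (f (n + 1))) ∧
          (∀ j ≤ n, (Literature.Probability.LatticeModels.zdGraph 2).Adj (f j) (f (j + 1)) ∧
            s(f j, f (j + 1)) ∈ ω) ∧
          ∀ j ≤ n + 1, Metric.infDist (Literature.Probability.LatticeModels.meshPoint δ (f j)) K ≤ δ := by
  sorry

/-- **stub_sandwichLowerOfWalks** (S1a, deterministic geometry of G02's discretisation; the hardest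
stub): GIVEN the walk-extraction lemma (S1a-W, stated verbatim as the hypothesis), for a square model
`Φ` of the conformal rectangle `R` and `0 < s` (`< 1`), at every small enough mesh `δ` the continuum
crossing event of the tall-narrow perturbation `T_s = Φ([-1+s, 1-s] × [-1-s, 1+s])` (arc `0` =
`Φ`(bottom side), arc `2` = `Φ`(top side)) is contained in G02's discrete crossing event of `R`
between the discretised arcs `0` and `2`. -/
theorem stub_sandwichLowerOfWalks :
    (∀ (δ : ℝ), 0 < δ → ∀ (ω : Literature.Probability.Percolation.BondConfig (Literature.Probability.LatticeModels.Site 2))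
      (K : Set ℂ), IsCompact K → IsConnected K →
      K ⊆ Literature.Probability.Percolation.openEdgeUnion δ ω → ∀ a ∈ K, ∀ b ∈ K,
        ∃ (n : ℕ) (f : ℕ → Literature.Probability.LatticeModels.Site 2),
          a ∈ segment ℝ (Literature.Probability.LatticeModels.meshPoint δ (f 0))
              (Literature.Probability.LatticeModels.meshPoint δ (f 1)) ∧
          b ∈ segment ℝ (Literature.Probability.LatticeModels.meshPoint δ (f n))
              (Literature.Probability.LatticeModels.meshPoint δ (f (n + 1))) ∧
          (∀ j ≤ n, (Literature.Probability.LatticeModels.zdGraph 2).Adj (f j) (f (j + 1)) ∧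
            s(f j, f (j + 1)) ∈ ω) ∧
          ∀ j ≤ n + 1, Metric.infDist (Literature.Probability.LatticeModels.meshPoint δ (f j)) K ≤ δ) →
    ∀ (R : Literature.Probability.RandomPlanarGeometry.ConformalRectangle) (Φ : ℂ ≃ₜ ℂ),
      Literature.Probability.Percolation.IsSquareModel R Φ →
      ∀ (s : ℝ) (hx : (-1 + s : ℝ) < 1 - s) (hy : (-1 - s : ℝ) < 1 + s), 0 < s →
        ∃ δ₀ > (0 : ℝ), ∀ δ : ℝ, 0 < δ → δ < δ₀ →
          Literature.Probability.Percolation.quadCrossing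
              (Literature.Probability.Percolation.perturbQuad Φ (-1 + s) (1 - s) (-1 - s) (1 + s) hx hy) δ ⊆
            Literature.Probability.Percolation.discreteCrossing R.carrier δ (R.arc 0) (R.arc 2) := by
  sorry

/-- **stub_sandwichLowerChains** (S1a-C, registered one-line form of the chain-selection lemma
`exists_good_run` of the helper file `…StubSandwichLowerChains.lean` of S1a; pure combinatorics):
along edges `0, …, n` classified good / low / high (non-good ⇒ low or high, never both; edge `0`
low non-good, edge `n` high non-good, a low non-good edge never immediately followed by a high
non-good one) there is a run of good edges from a low non-good edge `k₁` to a high non-good edge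
`k₂ > k₁ + 1`. Registered only so that the helper file can ride with the line (`--supports`). -/
theorem stub_sandwichLowerChains :
    ∀ (n : ℕ) (good low high : ℕ → Prop), (∀ j ≤ n, ¬ good j → low j ∨ high j) →
      (∀ j ≤ n, ¬ (low j ∧ high j)) → (¬ good 0 ∧ low 0) → (¬ good n ∧ high n) →
      (∀ j < n, ¬ good j → low j → ¬ good (j + 1) → high (j + 1) → False) →
      ∃ k₁ k₂ : ℕ, k₁ + 1 < k₂ ∧ k₂ ≤ n ∧ (¬ good k₁ ∧ low k₁) ∧ (¬ good k₂ ∧ high k₂) ∧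
        ∀ m, k₁ < m → m < k₂ → good m := by
  sorry

/-- **stub_sandwichLowerGeometry** (S1a-G, registered one-line form of the band-separation lemma
`exists_sep_low` of the helper file `…StubSandwichLowerGeometry.lean` of S1a): for a square model
`Φ` of `R` and `0 < s`, points whose model coordinates lie in the low band
`[-1+s/2, 1-s/2] × [-1, -1/2]` are at `infDist` more than some `ρ > 0` from `frontier Ω ∖ arc 0`.
Registered only so that the helper file can ride with the line (`--supports`). -/
theorem stub_sandwichLowerGeometry :
    ∀ (R : Literature.Probability.RandomPlanarGeometry.ConformalRectangle) (Φ : ℂ ≃ₜ ℂ),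
      Literature.Probability.Percolation.IsSquareModel R Φ → ∀ (s : ℝ), 0 < s →
        ∃ ρ > (0 : ℝ), ∀ z : ℂ, (Φ.symm z).re ∈ Set.Icc (-1 + s / 2) (1 - s / 2) →
          (Φ.symm z).im ∈ Set.Icc (-1 : ℝ) (-1 / 2) → ρ < Metric.infDist z (frontier R.carrier \ R.arc 0) := by
  sorry

/-- **stub_sandwichUpper** (S1b, deterministic geometry of G02's discretisation): for a square
model `Φ` of `R` and `0 < s` (`< 1`), at every small enough mesh `δ` G02's discrete crossing event
of `R` is contained in the continuum crossing event of the wide-short perturbation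
`W_s = Φ([-1-s, 1+s] × [-1+s, 1-s])`. -/
theorem stub_sandwichUpper :
    ∀ (R : Literature.Probability.RandomPlanarGeometry.ConformalRectangle) (Φ : ℂ ≃ₜ ℂ),
      Literature.Probability.Percolation.IsSquareModel R Φ →
      ∀ (s : ℝ) (hx : (-1 - s : ℝ) < 1 + s) (hy : (-1 + s : ℝ) < 1 - s), 0 < s →
        ∃ δ₀ > (0 : ℝ), ∀ δ : ℝ, 0 < δ → δ < δ₀ →
          Literature.Probability.Percolation.discreteCrossing R.carrier δ (R.arc 0) (R.arc 2) ⊆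
            Literature.Probability.Percolation.quadCrossing
              (Literature.Probability.Percolation.perturbQuad Φ (-1 - s) (1 + s) (-1 + s) (1 - s) hx hy) δ := by
  sorry

/-- **stub_perturbationContinuity** (S1c, the percolation input: Schramm–Smirnov's discrete
continuity estimate (5.1), proved in the tree, combined with exact dilation covariance of the raw
crossing events): for every plane homeomorphism `Φ` and `ε > 0` there are a perturbation size
`s > 0`, a ratio margin `θ > 0` and a mesh bound `δ₁ > 0` such that for all meshes
`0 < δ ≤ δ' < δ₁` with `δ' ≤ (1 + θ) δ` the crossing probability of the wide-short perturbation
`W_s` at one mesh exceeds that of the tall-narrow perturbation `T_s` at the other mesh by less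
than `ε`, in both orders. -/
theorem stub_perturbationContinuity :
    ∀ (Φ : ℂ ≃ₜ ℂ) (ε : ℝ), 0 < ε →
      ∃ (s : ℝ) (hxT : (-1 + s : ℝ) < 1 - s) (hyT : (-1 - s : ℝ) < 1 + s)
        (hxW : (-1 - s : ℝ) < 1 + s) (hyW : (-1 + s : ℝ) < 1 - s), 0 < s ∧
        ∃ θ > (0 : ℝ), ∃ δ₁ > (0 : ℝ), ∀ δ δ' : ℝ, 0 < δ → δ ≤ δ' → δ' < δ₁ → δ' ≤ (1 + θ) * δ →
          (Literature.Probability.Percolation.bondPercolation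
                (Literature.Probability.LatticeModels.zdGraph 2) Literature.Probability.Percolation.half).real
              (Literature.Probability.Percolation.quadCrossing
                (Literature.Probability.Percolation.perturbQuad Φ (-1 - s) (1 + s) (-1 + s) (1 - s) hxW hyW) δ) -
            (Literature.Probability.Percolation.bondPercolation
                (Literature.Probability.LatticeModels.zdGraph 2) Literature.Probability.Percolation.half).real
              (Literature.Probability.Percolation.quadCrossing
                (Literature.Probability.Percolation.perturbQuad Φ (-1 + s) (1 - s) (-1 - s) (1 + s) hxT hyT) δ') < ε ∧
          (Literature.Probability.Percolation.bondPercolation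
                (Literature.Probability.LatticeModels.zdGraph 2) Literature.Probability.Percolation.half).real
              (Literature.Probability.Percolation.quadCrossing
                (Literature.Probability.Percolation.perturbQuad Φ (-1 - s) (1 + s) (-1 + s) (1 - s) hxW hyW) δ') -
            (Literature.Probability.Percolation.bondPercolation
                (Literature.Probability.LatticeModels.zdGraph 2) Literature.Probability.Percolation.half).real
              (Literature.Probability.Percolation.quadCrossing
                (Literature.Probability.Percolation.perturbQuad Φ (-1 + s) (1 - s) (-1 - s) (1 + s) hxT hyT) δ) < ε := by
  sorry

/-- **stub_clusterSetPreconnected** (S2, size M; pure point-set topology, model-free): for any index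
type `ι`, any path `p : ℝ → (ι → ℝ)` taking values in a compact set `K` at positive times, if every
coordinate `δ ↦ p δ i` is asymptotically continuous in `log δ` at `0⁺` (the `(θ, δ₀)`-form), then
the cluster set `{g | MapClusterPt g (𝓝[>] 0) p}` is preconnected in the product topology.
(Product form of "the ω-limit set of a precompact asymptotically continuous path is connected",
Hale 2010 Lemma 3.1.1; proof: the cluster set is closed in the compact `K`; two disjoint compact
pieces are separated on finitely many coordinates; the tail of the path is confined near the cluster
set (`IsCompact.exists_mapClusterPt_of_frequently`); the hypothesis makes both visit sets open in an
interval `Ioo 0 t`, contradicting `isPreconnected_Ioo`.) -/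
theorem stub_clusterSetPreconnected :
    ∀ (ι : Type) (p : ℝ → ι → ℝ) (K : Set (ι → ℝ)), IsCompact K → (∀ δ : ℝ, 0 < δ → p δ ∈ K) →
      (∀ (i : ι) (ε : ℝ), 0 < ε → ∃ θ > (0 : ℝ), ∃ δ₀ > (0 : ℝ), ∀ δ δ' : ℝ,
        0 < δ → δ ≤ δ' → δ' < δ₀ → δ' ≤ (1 + θ) * δ → |p δ' i - p δ i| < ε) →
      IsPreconnected {g : ι → ℝ | MapClusterPt g (nhdsWithin (0 : ℝ) (Set.Ioi 0)) p} := by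
  sorry

/-! ### Name-keyed aliases of the five statements

The hypotheses of the composition: the skeleton audit admits a hypothesis only if its head
constant is a registered obligation or is named like a declared stub. The bodies are byte-identical
to the stub types above. -/
namespace Registered

/-- The statement of `stub_walkExtraction` (S1a-W), keyed by the registered stub name. -/
abbrev stub_walkExtraction : Prop :=
    ∀ (δ : ℝ), 0 < δ → ∀ (ω : Literature.Probability.Percolation.BondConfig (Literature.Probability.LatticeModels.Site 2))
      (K : Set ℂ), IsCompact K → IsConnected K →
      K ⊆ Literature.Probability.Percolation.openEdgeUnion δ ω → ∀ a ∈ K, ∀ b ∈ K,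
        ∃ (n : ℕ) (f : ℕ → Literature.Probability.LatticeModels.Site 2),
          a ∈ segment ℝ (Literature.Probability.LatticeModels.meshPoint δ (f 0))
              (Literature.Probability.LatticeModels.meshPoint δ (f 1)) ∧
          b ∈ segment ℝ (Literature.Probability.LatticeModels.meshPoint δ (f n))
              (Literature.Probability.LatticeModels.meshPoint δ (f (n + 1))) ∧
          (∀ j ≤ n, (Literature.Probability.LatticeModels.zdGraph 2).Adj (f j) (f (j + 1)) ∧
            s(f j, f (j + 1)) ∈ ω) ∧
          ∀ j ≤ n + 1, Metric.infDist (Literature.Probability.LatticeModels.meshPoint δ (f j)) K ≤ δ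

/-- The statement of `stub_sandwichLowerOfWalks` (S1a), keyed by the registered stub name. -/
abbrev stub_sandwichLowerOfWalks : Prop :=
    (∀ (δ : ℝ), 0 < δ → ∀ (ω : Literature.Probability.Percolation.BondConfig (Literature.Probability.LatticeModels.Site 2))
      (K : Set ℂ), IsCompact K → IsConnected K →
      K ⊆ Literature.Probability.Percolation.openEdgeUnion δ ω → ∀ a ∈ K, ∀ b ∈ K,
        ∃ (n : ℕ) (f : ℕ → Literature.Probability.LatticeModels.Site 2),
          a ∈ segment ℝ (Literature.Probability.LatticeModels.meshPoint δ (f 0))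
              (Literature.Probability.LatticeModels.meshPoint δ (f 1)) ∧
          b ∈ segment ℝ (Literature.Probability.LatticeModels.meshPoint δ (f n))
              (Literature.Probability.LatticeModels.meshPoint δ (f (n + 1))) ∧
          (∀ j ≤ n, (Literature.Probability.LatticeModels.zdGraph 2).Adj (f j) (f (j + 1)) ∧
            s(f j, f (j + 1)) ∈ ω) ∧
          ∀ j ≤ n + 1, Metric.infDist (Literature.Probability.LatticeModels.meshPoint δ (f j)) K ≤ δ) →
    ∀ (R : Literature.Probability.RandomPlanarGeometry.ConformalRectangle) (Φ : ℂ ≃ₜ ℂ),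
      Literature.Probability.Percolation.IsSquareModel R Φ →
      ∀ (s : ℝ) (hx : (-1 + s : ℝ) < 1 - s) (hy : (-1 - s : ℝ) < 1 + s), 0 < s →
        ∃ δ₀ > (0 : ℝ), ∀ δ : ℝ, 0 < δ → δ < δ₀ →
          Literature.Probability.Percolation.quadCrossing
              (Literature.Probability.Percolation.perturbQuad Φ (-1 + s) (1 - s) (-1 - s) (1 + s) hx hy) δ ⊆
            Literature.Probability.Percolation.discreteCrossing R.carrier δ (R.arc 0) (R.arc 2)

/-- The sandwich's lower half (S1a-W + S1a combined): `𝒞_δ(T_s) ⊆ discreteCrossing` for small `δ`. -/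
abbrev SandwichLower : Prop :=
    ∀ (R : Literature.Probability.RandomPlanarGeometry.ConformalRectangle) (Φ : ℂ ≃ₜ ℂ),
      Literature.Probability.Percolation.IsSquareModel R Φ →
      ∀ (s : ℝ) (hx : (-1 + s : ℝ) < 1 - s) (hy : (-1 - s : ℝ) < 1 + s), 0 < s →
        ∃ δ₀ > (0 : ℝ), ∀ δ : ℝ, 0 < δ → δ < δ₀ →
          Literature.Probability.Percolation.quadCrossing
              (Literature.Probability.Percolation.perturbQuad Φ (-1 + s) (1 - s) (-1 - s) (1 + s) hx hy) δ ⊆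
            Literature.Probability.Percolation.discreteCrossing R.carrier δ (R.arc 0) (R.arc 2)

/-- The statement of `stub_sandwichUpper` (S1b), keyed by the registered stub name. -/
abbrev stub_sandwichUpper : Prop :=
    ∀ (R : Literature.Probability.RandomPlanarGeometry.ConformalRectangle) (Φ : ℂ ≃ₜ ℂ),
      Literature.Probability.Percolation.IsSquareModel R Φ →
      ∀ (s : ℝ) (hx : (-1 - s : ℝ) < 1 + s) (hy : (-1 + s : ℝ) < 1 - s), 0 < s →
        ∃ δ₀ > (0 : ℝ), ∀ δ : ℝ, 0 < δ → δ < δ₀ →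
          Literature.Probability.Percolation.discreteCrossing R.carrier δ (R.arc 0) (R.arc 2) ⊆
            Literature.Probability.Percolation.quadCrossing
              (Literature.Probability.Percolation.perturbQuad Φ (-1 - s) (1 + s) (-1 + s) (1 - s) hx hy) δ

/-- The statement of `stub_perturbationContinuity` (S1c), keyed by the registered stub name. -/
abbrev stub_perturbationContinuity : Prop :=
    ∀ (Φ : ℂ ≃ₜ ℂ) (ε : ℝ), 0 < ε →
      ∃ (s : ℝ) (hxT : (-1 + s : ℝ) < 1 - s) (hyT : (-1 - s : ℝ) < 1 + s)
        (hxW : (-1 - s : ℝ) < 1 + s) (hyW : (-1 + s : ℝ) < 1 - s), 0 < s ∧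
        ∃ θ > (0 : ℝ), ∃ δ₁ > (0 : ℝ), ∀ δ δ' : ℝ, 0 < δ → δ ≤ δ' → δ' < δ₁ → δ' ≤ (1 + θ) * δ →
          (Literature.Probability.Percolation.bondPercolation
                (Literature.Probability.LatticeModels.zdGraph 2) Literature.Probability.Percolation.half).real
              (Literature.Probability.Percolation.quadCrossing
                (Literature.Probability.Percolation.perturbQuad Φ (-1 - s) (1 + s) (-1 + s) (1 - s) hxW hyW) δ) -
            (Literature.Probability.Percolation.bondPercolation
                (Literature.Probability.LatticeModels.zdGraph 2) Literature.Probability.Percolation.half).real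
              (Literature.Probability.Percolation.quadCrossing
                (Literature.Probability.Percolation.perturbQuad Φ (-1 + s) (1 - s) (-1 - s) (1 + s) hxT hyT) δ') < ε ∧
          (Literature.Probability.Percolation.bondPercolation
                (Literature.Probability.LatticeModels.zdGraph 2) Literature.Probability.Percolation.half).real
              (Literature.Probability.Percolation.quadCrossing
                (Literature.Probability.Percolation.perturbQuad Φ (-1 - s) (1 + s) (-1 + s) (1 - s) hxW hyW) δ') -
            (Literature.Probability.Percolation.bondPercolation
                (Literature.Probability.LatticeModels.zdGraph 2) Literature.Probability.Percolation.half).real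
              (Literature.Probability.Percolation.quadCrossing
                (Literature.Probability.Percolation.perturbQuad Φ (-1 + s) (1 - s) (-1 - s) (1 + s) hxT hyT) δ) < ε

/-- The statement of `stub_clusterSetPreconnected` (S2), keyed by the registered stub name. -/
abbrev stub_clusterSetPreconnected : Prop :=
    ∀ (ι : Type) (p : ℝ → ι → ℝ) (K : Set (ι → ℝ)), IsCompact K → (∀ δ : ℝ, 0 < δ → p δ ∈ K) →
      (∀ (i : ι) (ε : ℝ), 0 < ε → ∃ θ > (0 : ℝ), ∃ δ₀ > (0 : ℝ), ∀ δ δ' : ℝ,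
        0 < δ → δ ≤ δ' → δ' < δ₀ → δ' ≤ (1 + θ) * δ → |p δ' i - p δ i| < ε) →
      IsPreconnected {g : ι → ℝ | MapClusterPt g (nhdsWithin (0 : ℝ) (Set.Ioi 0)) p}

end Registered

/-! ### The composition: the five stubs imply the crux, by name (no `sorry`) -/

/-- **S1 = `ScaleContinuity` (item stmt-CriticalPhenomena-5770) from S1a-W + S1a + S1b + S1c.** Take a
square model `Φ` of `R` (`exists_isSquareModel`), the data `s, θ, δ₁` of S1c for `(Φ, ε)` and the
sandwich thresholds of S1a/S1b at that `s`; below all three thresholds,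
`p_R(δ') - p_R(δ) ≤ P[𝒞_{δ'}(W_s)] - P[𝒞_δ(T_s)] < ε` and
`p_R(δ) - p_R(δ') ≤ P[𝒞_δ(W_s)] - P[𝒞_{δ'}(T_s)] < ε` by monotonicity of the measure along
`𝒞(T_s) ⊆ discreteCrossing ⊆ 𝒞(W_s)` at each mesh. -/
theorem scaleContinuity_of_stubs (h₀ : Registered.stub_walkExtraction)
    (h₁' : Registered.stub_sandwichLowerOfWalks)
    (h₂ : Registered.stub_sandwichUpper) (h₃ : Registered.stub_perturbationContinuity) :
    Summit.CriticalPhenomena.CardyFormulaZ2.Theses.CardyLocalRigidity.ScaleContinuity := by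
  have h₁ : Registered.SandwichLower := h₁' h₀
  intro R ε hε
  obtain ⟨Φ, hΦ⟩ := exists_isSquareModel R
  obtain ⟨s, hxT, hyT, hxW, hyW, hs, θ, hθ, δ₁, hδ₁, H⟩ := h₃ Φ ε hε
  obtain ⟨δa, hδa, Ha⟩ := h₁ R Φ hΦ s hxT hyT hs
  obtain ⟨δb, hδb, Hb⟩ := h₂ R Φ hΦ s hxW hyW hs
  refine ⟨θ, hθ, min δ₁ (min δa δb), lt_min hδ₁ (lt_min hδa hδb), ?_⟩
  intro δ δ' hδ hδδ' hδ'lt hratio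
  have hδ' : 0 < δ' := hδ.trans_le hδδ'
  have hδ'₁ : δ' < δ₁ := hδ'lt.trans_le (min_le_left _ _)
  have hδ'a : δ' < δa := hδ'lt.trans_le ((min_le_right _ _).trans (min_le_left _ _))
  have hδ'b : δ' < δb := hδ'lt.trans_le ((min_le_right _ _).trans (min_le_right _ _))
  have hδa' : δ < δa := hδδ'.trans_lt hδ'a
  have hδb' : δ < δb := hδδ'.trans_lt hδ'b
  obtain ⟨H1, H2⟩ := H δ δ' hδ hδδ' hδ'₁ hratio
  -- notation: the law, G02's events at the two meshes and the four perturbation events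
  set P := bondPercolation (zdGraph 2) half with hP
  set W := perturbQuad Φ (-1 - s) (1 + s) (-1 + s) (1 - s) hxW hyW with hW
  set T := perturbQuad Φ (-1 + s) (1 - s) (-1 - s) (1 + s) hxT hyT with hT
  -- unfold the crossing probabilities to `P.real` of G02's events
  rw [bondDomainCrossingProb_eq_measureReal, bondDomainCrossingProb_eq_measureReal]
  -- monotonicity along the sandwich at each mesh
  have hup' : P.real (discreteCrossing R.carrier δ' (R.arc 0) (R.arc 2)) ≤ P.real (quadCrossing W δ') :=
    measureReal_mono (Hb δ' hδ' hδ'b)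
  have hup : P.real (discreteCrossing R.carrier δ (R.arc 0) (R.arc 2)) ≤ P.real (quadCrossing W δ) :=
    measureReal_mono (Hb δ hδ hδb')
  have hlow' : P.real (quadCrossing T δ') ≤ P.real (discreteCrossing R.carrier δ' (R.arc 0) (R.arc 2)) :=
    measureReal_mono (Ha δ' hδ' hδ'a)
  have hlow : P.real (quadCrossing T δ) ≤ P.real (discreteCrossing R.carrier δ (R.arc 0) (R.arc 2)) :=
    measureReal_mono (Ha δ hδ hδa')
  rw [abs_sub_lt_iff]
  constructor <;> linarith

/-- **`ClusterSetConnected` from the five stubs.** Instantiate the topological lemma S2 at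
`ι := ConformalRectangle`, `p δ R := bondDomainCrossingProb R δ`, the compact box
`K := [0,1]^ConformalRectangle` (Tychonoff `isCompact_univ_pi`; membership by
`bondDomainCrossingProb_mem_Icc`), and feed it S1 (`scaleContinuity_of_stubs`) coordinate by
coordinate. The conclusion is literally the route declaration (`𝓝[>] 0` is `nhdsWithin 0 (Set.Ioi 0)`). -/
theorem ClusterSetConnected_of (h₀ : Registered.stub_walkExtraction)
    (h₁ : Registered.stub_sandwichLowerOfWalks)
    (h₂ : Registered.stub_sandwichUpper) (h₃ : Registered.stub_perturbationContinuity)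
    (h₄ : Registered.stub_clusterSetPreconnected) :
    Summit.CriticalPhenomena.CardyFormulaZ2.Theses.CardyAnchoredRigidity.ClusterSetConnected := by
  have hS1 := scaleContinuity_of_stubs h₀ h₁ h₂ h₃
  -- the compact box [0,1]^ConformalRectangle containing every crossing function
  have hK : IsCompact (Set.pi Set.univ (fun _ : ConformalRectangle => Set.Icc (0 : ℝ) 1)) :=
    isCompact_univ_pi fun _ => isCompact_Icc
  have hPK : ∀ δ : ℝ, 0 < δ →
      (fun R : ConformalRectangle => bondDomainCrossingProb R δ) ∈
        Set.pi Set.univ (fun _ : ConformalRectangle => Set.Icc (0 : ℝ) 1) :=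
    fun δ _ => Set.mem_univ_pi.2 fun R => bondDomainCrossingProb_mem_Icc R δ
  -- S2 at the crossing-function path, fed by S1 coordinatewise
  exact h₄ ConformalRectangle (fun (δ : ℝ) (R : ConformalRectangle) => bondDomainCrossingProb R δ)
    (Set.pi Set.univ (fun _ : ConformalRectangle => Set.Icc (0 : ℝ) 1)) hK hPK
    (fun R ε hε => hS1 R ε hε)

/-- The crux is ONE shared item (stmt-CriticalPhenomena-5769) rendered in two route files: the two
declarations are the same term. -/
theorem crux_shared_iff :
    Summit.CriticalPhenomena.CardyFormulaZ2.Theses.CardyAnchoredRigidity.ClusterSetConnected ↔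
      Summit.CriticalPhenomena.CardyFormulaZ2.Theses.CardyLocalRigidity.ClusterSetConnected :=
  Iff.rfl

/-- **Skeleton theorem** (registry shape `<Crux>_proof : <crux decl> := <line>_of stub₁ … stub_k`):
the crux — under the item's default decl name `CardyLocalRigidity.ClusterSetConnected`, definitionally
the `CardyAnchoredRigidity` one — from the five registered (sorried) stubs through
`ClusterSetConnected_of`. It becomes the crux proof when the last stub is discharged; it contains no
`sorry` of its own. -/
theorem ClusterSetConnected_proof :
    Summit.CriticalPhenomena.CardyFormulaZ2.Theses.CardyLocalRigidity.ClusterSetConnected :=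
  ClusterSetConnected_of stub_walkExtraction stub_sandwichLowerOfWalks stub_sandwichUpper
    stub_perturbationContinuity stub_clusterSetPreconnected

/-- Wiring check under this route's own decl name. -/
example : Summit.CriticalPhenomena.CardyFormulaZ2.Theses.CardyAnchoredRigidity.ClusterSetConnected :=
  ClusterSetConnected_of stub_walkExtraction stub_sandwichLowerOfWalks stub_sandwichUpper
    stub_perturbationContinuity stub_clusterSetPreconnected

/-- The support item `ScaleContinuity` (stmt-CriticalPhenomena-5770) rides with the line: it is the
conjunction S1a ∧ S1b ∧ S1c read through `scaleContinuity_of_stubs`. -/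
theorem ScaleContinuity_proof :
    Summit.CriticalPhenomena.CardyFormulaZ2.Theses.CardyLocalRigidity.ScaleContinuity :=
  scaleContinuity_of_stubs stub_walkExtraction stub_sandwichLowerOfWalks stub_sandwichUpper
    stub_perturbationContinuity

end Summit.CriticalPhenomena.CardyFormulaZ2.Cruxes.ClusterSetConnected.Birth
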